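import Mathlib
import Literature.Combinatorics.Additive.TripleProductProperty
import Summits.MatrixMultiplication.MatrixMultiplication.Theorems.SnSubsetDichotomyHyperoctahedralThresholdCliquePacking

/-!
# Clique certificate, exemplar: the Klein host on four points is tight
(crux `HyperoctahedralThreshold`, stmt-MatrixMultiplication-10883, certificate track, lead c4)

The smallest hyperoctahedral host triple: `n = 4`, the three perfect matchings of `K₄`,
`μ₀ = (0 1)(2 3)`, `μ₁ = (0 2)(1 3)`, `μ₂ = (0 3)(1 2)` (the one-factorisation of `K₄`; the `μ_i`
generate the Klein four-group `V`, and `C(μ_i) ≅ D₄` has order `8`).  The sixteen triples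
`{(a, b, (ab)⁻¹) : a, b ∈ V}` are hosted and form a clique for the relation
`a a'⁻¹ (b b'⁻¹) (c c'⁻¹) = 1` (indeed a group of triples with product one, `V` being abelian and
central in each `C(μ_i)`), so by clique packing (`CliquePacking.vol_le_div_of_clique`, p116018)
every TPP triple `X_i ⊆ C(μ_i)` has `|X₀||X₁||X₂| ≤ 8³ / 16 = 32` (`klein_volume_le`); and `32` is
attained by `X₀ = C(μ₀)`, `X₁ = {1, (1 3)}`, `X₂ = {1, (1 2)}` (`klein_volume_eq`), so the clique
bound is TIGHT here.  Everything is checked by `decide` (kernel), no `native_decide`.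

This file is the format exemplar for clique certificates: a host triple, an explicit clique `K`
(kilobytes), `decide` for "hosted" and "pairwise related", and the division.  For comparison the exact
census by SAT needs an LRAT refutation per host (`Negative/HostedTPPSAT.lean`).
-/

set_option linter.dupNamespace false

namespace Summit.MatrixMultiplication.MatrixMultiplication.Theorems.HyperoctahedralThreshold

namespace CliqueCertK4

open Literature.Combinatorics.Additive Equiv

/-- The Klein host: the three perfect matchings of `K₄` as fixed-point-free involutions of `Fin 4`. -/
local notation "μK" => (![swap 0 1 * swap 2 3, swap 0 2 * swap 1 3, swap 0 3 * swap 1 2] :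
  Fin 3 → Perm (Fin 4))

/-- The Klein four-group `V = {1, μ₀, μ₁, μ₂}` as a `Finset`. -/
local notation "VK" => ({1, (⟨![1, 0, 3, 2], ![1, 0, 3, 2], by decide, by decide⟩ : Perm (Fin 4)),
  (⟨![2, 3, 0, 1], ![2, 3, 0, 1], by decide, by decide⟩ : Perm (Fin 4)),
  (⟨![3, 2, 1, 0], ![3, 2, 1, 0], by decide, by decide⟩ : Perm (Fin 4))} : Finset (Perm (Fin 4)))

/-- The certificate: the sixteen hosted triples `(a, b, (ab)⁻¹)`, `a, b ∈ V`. -/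
local notation "KK" => (Finset.image (fun p : Perm (Fin 4) × Perm (Fin 4) =>
  (Prod.fst p, Prod.snd p, (Prod.fst p * Prod.snd p)⁻¹))
  (VK ×ˢ VK))

/-- The certificate has sixteen members. [folklore] -/
theorem card_KK : (KK).card = 16 := by decide

/-- Every member of the certificate is hosted: its coordinates commute with `μ₀, μ₁, μ₂`
respectively. [folklore] -/
theorem hosted_KK : ∀ k ∈ KK, k.1 * μK 0 = μK 0 * k.1 ∧ k.2.1 * μK 1 = μK 1 * k.2.1 ∧
    k.2.2 * μK 2 = μK 2 * k.2.2 := by decide +kernel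

/-- The certificate is a clique: any two distinct members are related (here always in the first
order, `K` being a group of triples with product one). [folklore] -/
theorem clique_KK : ∀ k ∈ KK, ∀ k' ∈ KK, k ≠ k' →
    k.1 * k'.1⁻¹ * (k.2.1 * k'.2.1⁻¹) * (k.2.2 * k'.2.2⁻¹) = 1 ∨
      k'.1 * k.1⁻¹ * (k'.2.1 * k.2.1⁻¹) * (k'.2.2 * k.2.2⁻¹) = 1 := by decide +kernel

/-- Each host `C(μ_i)` (a dihedral group of order eight) has `8` elements. [folklore] -/
theorem card_host : ∀ i : Fin 3,
    (Finset.univ.filter (fun σ : Perm (Fin 4) => σ * μK i = μK i * σ)).card = 8 := by decide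

/-- **Klein host, upper bound.**  Every TPP triple hosted by the one-factorisation of `K₄` has
volume at most `32 = 8³/16` (clique packing with the sixteen-member certificate). [folklore] -/
theorem klein_volume_le (X : Fin 3 → Finset (Perm (Fin 4)))
    (hX : ∀ i, ∀ σ ∈ X i, σ * μK i = μK i * σ)
    (hTPP : TripleProductProperty (X 0) (X 1) (X 2)) :
    (X 0).card * (X 1).card * (X 2).card ≤ 32 := by
  have h := CliquePacking.vol_le_div_of_clique 4 μK X KK hX hTPP hosted_KK clique_KK
    (Finset.card_pos.1 (by rw [card_KK]; norm_num))
  rw [card_host 0, card_host 1, card_host 2, card_KK] at h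
  exact le_trans h (by norm_num)

/-- **Klein host, the bound is attained**: `X₀ = C(μ₀)`, `X₁ = {1, (1 3)}`, `X₂ = {1, (1 2)}` is a
hosted TPP triple of volume `8 · 2 · 2 = 32`. [folklore] -/
theorem klein_volume_eq :
    ∃ X : Fin 3 → Finset (Perm (Fin 4)), (∀ i, ∀ σ ∈ X i, σ * μK i = μK i * σ) ∧
      TripleProductProperty (X 0) (X 1) (X 2) ∧ (X 0).card * (X 1).card * (X 2).card = 32 := by
  refine ⟨![Finset.univ.filter (fun σ : Perm (Fin 4) => σ * μK 0 = μK 0 * σ), {1, (⟨![0, 3, 2, 1], ![0, 3, 2, 1], by decide, by decide⟩ : Perm (Fin 4))},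
    {1, (⟨![0, 2, 1, 3], ![0, 2, 1, 3], by decide, by decide⟩ : Perm (Fin 4))}], by decide, by unfold TripleProductProperty; decide, by decide⟩

end CliqueCertK4

/-- **Stub `stub_cliqueCertK4` — the Klein host certificate** (crux `SnSubsetDichotomy.HyperoctahedralThreshold`,
stmt-MatrixMultiplication-10883, certificate track): every TPP triple hosted by the one-factorisation of `K₄`
(`μ₀ = (0 1)(2 3)`, `μ₁ = (0 2)(1 3)`, `μ₂ = (0 3)(1 2)`) has volume `≤ 32 = 8³/16`; tight by
`CliqueCertK4.klein_volume_eq`.  Restates `CliqueCertK4.klein_volume_le` with the host written out. [folklore] -/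
theorem stub_cliqueCertK4 : ∀ X : Fin 3 → Finset (Equiv.Perm (Fin 4)), (∀ i, ∀ σ ∈ X i, σ * (![Equiv.swap 0 1 * Equiv.swap 2 3, Equiv.swap 0 2 * Equiv.swap 1 3, Equiv.swap 0 3 * Equiv.swap 1 2] : Fin 3 → Equiv.Perm (Fin 4)) i = (![Equiv.swap 0 1 * Equiv.swap 2 3, Equiv.swap 0 2 * Equiv.swap 1 3, Equiv.swap 0 3 * Equiv.swap 1 2] : Fin 3 → Equiv.Perm (Fin 4)) i * σ) → Literature.Combinatorics.Additive.TripleProductProperty (X 0) (X 1) (X 2) → (X 0).card * (X 1).card * (X 2).card ≤ 32 :=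
  CliqueCertK4.klein_volume_le

end Summit.MatrixMultiplication.MatrixMultiplication.Theorems.HyperoctahedralThreshold
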